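import Literature.Probability.RandomPlanarGeometry.LocalMartingaleProofs
import Literature.Probability.Distributions.GaussianVectorTilt
import Mathlib.MeasureTheory.Constructions.Projective
import HarnessLib

/-!
# Route `BECCutLineWeakDisorder` — crux `TwoReplicaTransienceBound` (stmt-AtomisticToContinuum-9687),
# line `tagged-shift-log-harnack`: the Cameron–Martin identity for a ramp drift (toolbox stub)

Helper file (`--supports stmt-AtomisticToContinuum-9687`), registered toolbox stub
`stub_cameronMartinRamp` of the line `tagged-shift-log-harnack`: the change-of-measure engine of
the line's lever. For the canonical Brownian motion `b = Literature.Probability.Process.brownian`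
on the canonical space `(ℝ≥0 → ℝ, preWienerMeasure)`, a slope `a : ℝ`, a time `τ₀ : ℝ≥0` and the
deterministic `H¹` ramp `h(s) = a · min(s, τ₀)` (`h' = a` on `[0, τ₀]`, `0` after, so
`∫ h' db = a b_{τ₀}` and `½ ∫ h'² = a² τ₀ / 2`):

  `E[G(b + h)] = E[G(b) · exp(a b_{τ₀} - a² τ₀ / 2)]`     for every measurable `G ≥ 0` on path space

(`stub_cameronMartinRamp`). This is the Cameron–Martin theorem (Cameron–Martin 1944;
Mörters–Peres, *Brownian Motion*, Thm 1.38; Karatzas–Shreve, §3.5) for the particular direction `h`.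

## Proof

Both sides are `∫⁻ G dμᵢ` for two finite measures on `ℝ≥0 → ℝ` (product σ-algebra):
`μ₁ = law of the shifted path`, `μ₂ = law of the path under the tilted measure
exp(a b_{τ₀} - a²τ₀/2) · P`. Two finite measures on the product space with the same finite-dimensional
marginals coincide (Mathlib's `IsProjectiveLimit.unique`). For a finite set of times `I ∋ τ₀` the
marginals agree by the **finite-dimensional** Cameron–Martin formula
`Literature.Probability.Distributions.map_add_eq_withDensity_of_hasGaussianLaw` applied to the
centred Gaussian vector `(b_t)_{t ∈ I}` (covariance `min s t`) in the direction
`c = a δ_{τ₀}`, for which `(Cov c)_t = a min(t, τ₀) = h(t)` and `⟨c, z⟩ - ⟨c, Cov c⟩/2 =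
a z_{τ₀} - a² τ₀/2`; a general finite `J` is handled through `insert τ₀ J`.
No new definitions are introduced.
-/

noncomputable section

open MeasureTheory ProbabilityTheory
open scoped ENNReal NNReal

namespace Summit.AtomisticToContinuum.BoseEinsteinCondensation.Cruxes.TwoReplicaTransienceBound.TaggedShiftLogHarnack

open Literature.Probability.Process Literature.Probability.RandomPlanarGeometry
  Literature.Probability.Distributions

/-- The Cameron–Martin density of the ramp, `ω ↦ exp(a b_{τ₀}(ω) - a² τ₀ / 2)`, is measurable.
[folklore] -/
theorem measurable_rampDensity (a : ℝ) (τ₀ : ℝ≥0) :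
    Measurable fun ω : ℝ≥0 → ℝ =>
      ENNReal.ofReal (Real.exp (a * brownian τ₀ ω - a ^ 2 * (τ₀ : ℝ) / 2)) := by
  fun_prop

/-- The path map `ω ↦ (s ↦ b_s(ω))` of the canonical Brownian motion is measurable for the product
σ-algebra. [folklore] -/
theorem measurable_brownianPath : Measurable fun (ω : ℝ≥0 → ℝ) (s : ℝ≥0) => brownian s ω :=
  measurable_pi_lambda _ fun s => measurable_brownian s

/-- The ramp-shifted path map `ω ↦ (s ↦ b_s(ω) + a min(s, τ₀))` is measurable. [folklore] -/
theorem measurable_rampPath (a : ℝ) (τ₀ : ℝ≥0) :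
    Measurable fun (ω : ℝ≥0 → ℝ) (s : ℝ≥0) => brownian s ω + a * ((min s τ₀ : ℝ≥0) : ℝ) :=
  measurable_pi_lambda _ fun s => (measurable_brownian s).add_const _

/-- **Finite-dimensional Cameron–Martin for the ramp.** For a finite set of times `I ∋ τ₀`, the law
of the shifted vector `(b_t + a min(t, τ₀))_{t ∈ I}` is the law of `(b_t)_{t ∈ I}` under the tilted
measure `exp(a b_{τ₀} - a² τ₀/2) · P` (the finite-dimensional Cameron–Martin formula in the
direction `a δ_{τ₀}`, whose image under the covariance `min` is the ramp). [folklore] -/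
theorem map_rampPath_restrict_eq (a : ℝ) (τ₀ : ℝ≥0) (I : Finset ℝ≥0) (h0 : τ₀ ∈ I) :
    preWienerMeasure.map (fun ω (i : I) => brownian i ω + a * ((min (i : ℝ≥0) τ₀ : ℝ≥0) : ℝ)) =
      ((preWienerMeasure.withDensity fun ω =>
          ENNReal.ofReal (Real.exp (a * brownian τ₀ ω - a ^ 2 * (τ₀ : ℝ) / 2))).map
        fun ω (i : I) => brownian i ω) := by
  classical
  have hB := isPreBrownianReal_brownian
  let t0 : I := ⟨τ₀, h0⟩
  have ht0 : ((t0 : I) : ℝ≥0) = τ₀ := rfl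
  have hg : Measurable fun (ω : ℝ≥0 → ℝ) (i : I) => brownian i ω :=
    measurable_pi_lambda _ fun i => measurable_brownian _
  have hf : Measurable fun z : I → ℝ =>
      ENNReal.ofReal (Real.exp (a * z t0 - a ^ 2 * (τ₀ : ℝ) / 2)) := by
    fun_prop
  -- Step 1: the tilt is a function of the `I`-vector (`τ₀ ∈ I`), so it passes through the vector map
  have hswap : ((preWienerMeasure.withDensity fun ω =>
          ENNReal.ofReal (Real.exp (a * brownian τ₀ ω - a ^ 2 * (τ₀ : ℝ) / 2))).map
        fun ω (i : I) => brownian i ω) =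
      (preWienerMeasure.map fun ω (i : I) => brownian i ω).withDensity
        fun z : I → ℝ => ENNReal.ofReal (Real.exp (a * z t0 - a ^ 2 * (τ₀ : ℝ) / 2)) := by
    ext s hs
    rw [Measure.map_apply hg hs, withDensity_apply _ (hg hs), withDensity_apply _ hs,
      setLIntegral_map hs hf hg]
  rw [hswap]
  -- Step 2: the finite-dimensional Cameron–Martin formula in the direction `a δ_{τ₀}`
  have hZ : HasGaussianLaw (fun ω (i : I) => brownian i ω) preWienerMeasure :=
    hB.isGaussianProcess.hasGaussianLaw I
  have hmean : ∀ i : I, ∫ ω, brownian i ω ∂preWienerMeasure = 0 := fun i => hB.integral_eval i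
  have ha : ∀ i : I, a * ((min (i : ℝ≥0) τ₀ : ℝ≥0) : ℝ) =
      ∑ j : I, cov[fun ω => brownian i ω, fun ω => brownian j ω; preWienerMeasure] *
        (if j = t0 then a else 0) := by
    intro i
    simp only [mul_ite, mul_zero, Finset.sum_ite_eq', Finset.mem_univ, if_true]
    rw [hB.covariance_fun_eval]
    rw [mul_comm]
  have hcm := map_add_eq_withDensity_of_hasGaussianLaw (P := preWienerMeasure)
    (fun (i : I) ω => brownian i ω) hZ hmean (fun j => if j = t0 then a else 0)
    (fun i => a * ((min (i : ℝ≥0) τ₀ : ℝ≥0) : ℝ)) ha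
  rw [hcm]
  congr 1
  funext z
  simp only [ite_mul, zero_mul, Finset.sum_ite_eq', Finset.mem_univ, if_true, ht0, min_self]
  congr 2
  ring

/-- **The law of the ramp-shifted Brownian path is the tilted Wiener law**: on the canonical space,
`law(b + h) = law of b under exp(a b_{τ₀} - a² τ₀/2) · P`, `h(s) = a min(s, τ₀)` (equality of two
finite measures on `ℝ≥0 → ℝ` with the same finite-dimensional marginals). Cameron–Martin (1944);
Mörters–Peres, *Brownian Motion* (2010), Thm 1.38. [folklore] -/
theorem map_rampPath_eq (a : ℝ) (τ₀ : ℝ≥0) :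
    preWienerMeasure.map (fun ω (s : ℝ≥0) => brownian s ω + a * ((min s τ₀ : ℝ≥0) : ℝ)) =
      (preWienerMeasure.withDensity fun ω =>
          ENNReal.ofReal (Real.exp (a * brownian τ₀ ω - a ^ 2 * (τ₀ : ℝ) / 2))).map
        fun ω (s : ℝ≥0) => brownian s ω := by
  classical
  haveI := isProbabilityMeasure_preWienerMeasure'
  -- marginals on finite sets of times containing `τ₀`
  have hI : ∀ I : Finset ℝ≥0, τ₀ ∈ I →
      (preWienerMeasure.map
          (fun ω (s : ℝ≥0) => brownian s ω + a * ((min s τ₀ : ℝ≥0) : ℝ))).map I.restrict =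
        ((preWienerMeasure.withDensity fun ω =>
            ENNReal.ofReal (Real.exp (a * brownian τ₀ ω - a ^ 2 * (τ₀ : ℝ) / 2))).map
          fun ω (s : ℝ≥0) => brownian s ω).map I.restrict := by
    intro I h0
    rw [Measure.map_map (Finset.measurable_restrict I) (measurable_rampPath a τ₀),
      Measure.map_map (Finset.measurable_restrict I) measurable_brownianPath]
    exact map_rampPath_restrict_eq a τ₀ I h0
  -- all marginals, through `insert τ₀ J`
  have hJ : ∀ J : Finset ℝ≥0,
      (preWienerMeasure.map
          (fun ω (s : ℝ≥0) => brownian s ω + a * ((min s τ₀ : ℝ≥0) : ℝ))).map J.restrict =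
        ((preWienerMeasure.withDensity fun ω =>
            ENNReal.ofReal (Real.exp (a * brownian τ₀ ω - a ^ 2 * (τ₀ : ℝ) / 2))).map
          fun ω (s : ℝ≥0) => brownian s ω).map J.restrict := by
    intro J
    have hJI : J ⊆ insert τ₀ J := Finset.subset_insert τ₀ J
    rw [← Finset.restrict₂_comp_restrict hJI,
      ← Measure.map_map (Finset.measurable_restrict₂ hJI) (Finset.measurable_restrict _),
      ← Measure.map_map (Finset.measurable_restrict₂ hJI) (Finset.measurable_restrict _),
      hI _ (Finset.mem_insert_self τ₀ J)]
  have h1 : IsProjectiveLimit (α := fun _ : ℝ≥0 => ℝ)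
      (preWienerMeasure.map (fun ω (s : ℝ≥0) => brownian s ω + a * ((min s τ₀ : ℝ≥0) : ℝ)))
      (fun J => (preWienerMeasure.map
        (fun ω (s : ℝ≥0) => brownian s ω + a * ((min s τ₀ : ℝ≥0) : ℝ))).map J.restrict) :=
    fun J => rfl
  have h2 : IsProjectiveLimit (α := fun _ : ℝ≥0 => ℝ)
      ((preWienerMeasure.withDensity fun ω =>
          ENNReal.ofReal (Real.exp (a * brownian τ₀ ω - a ^ 2 * (τ₀ : ℝ) / 2))).map
        fun ω (s : ℝ≥0) => brownian s ω)
      (fun J => (preWienerMeasure.map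
        (fun ω (s : ℝ≥0) => brownian s ω + a * ((min s τ₀ : ℝ≥0) : ℝ))).map J.restrict) :=
    fun J => (hJ J).symm
  exact h1.unique h2

/-- **Cameron–Martin identity for a ramp drift** (registered toolbox stub `stub_cameronMartinRamp`
of the line `tagged-shift-log-harnack`). For the canonical Brownian motion `b` on
`(ℝ≥0 → ℝ, preWienerMeasure)`, a slope `a`, a time `τ₀` and the ramp `h(s) = a min(s, τ₀)`
(`∫ h' db = a b_{τ₀}`, `½∫ h'² = a² τ₀/2`):
`E[G(b + h)] = E[G(b) exp(a b_{τ₀} - a² τ₀/2)]` for every measurable `G ≥ 0` on path space.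
R. H. Cameron, W. T. Martin, *Transformations of Wiener integrals under translations*, Ann. of
Math. 45 (1944), 386–396; P. Mörters, Y. Peres, *Brownian Motion* (2010), Thm 1.38;
I. Karatzas, S. Shreve, *Brownian Motion and Stochastic Calculus* (1991), §3.5. [folklore] -/
theorem stub_cameronMartinRamp : ∀ (a : ℝ) (τ₀ : ℝ≥0) (G : (ℝ≥0 → ℝ) → ℝ≥0∞), Measurable G →
    ∫⁻ ω, G (fun s => Literature.Probability.Process.brownian s ω + a * ((min s τ₀ : ℝ≥0) : ℝ))
        ∂Literature.Probability.Process.preWienerMeasure =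
      ∫⁻ ω, G (fun s => Literature.Probability.Process.brownian s ω) *
          ENNReal.ofReal (Real.exp (a * Literature.Probability.Process.brownian τ₀ ω -
            a ^ 2 * (τ₀ : ℝ) / 2))
        ∂Literature.Probability.Process.preWienerMeasure := by
  intro a τ₀ G hG
  calc ∫⁻ ω, G (fun s => brownian s ω + a * ((min s τ₀ : ℝ≥0) : ℝ)) ∂preWienerMeasure
      = ∫⁻ x, G x ∂(preWienerMeasure.map
          (fun ω (s : ℝ≥0) => brownian s ω + a * ((min s τ₀ : ℝ≥0) : ℝ))) :=
        (lintegral_map hG (measurable_rampPath a τ₀)).symm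
    _ = ∫⁻ x, G x ∂((preWienerMeasure.withDensity fun ω =>
            ENNReal.ofReal (Real.exp (a * brownian τ₀ ω - a ^ 2 * (τ₀ : ℝ) / 2))).map
          fun ω (s : ℝ≥0) => brownian s ω) := by rw [map_rampPath_eq]
    _ = ∫⁻ ω, G (fun s => brownian s ω) ∂(preWienerMeasure.withDensity fun ω =>
            ENNReal.ofReal (Real.exp (a * brownian τ₀ ω - a ^ 2 * (τ₀ : ℝ) / 2))) :=
        lintegral_map hG measurable_brownianPath
    _ = ∫⁻ ω, ENNReal.ofReal (Real.exp (a * brownian τ₀ ω - a ^ 2 * (τ₀ : ℝ) / 2)) *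
          G (fun s => brownian s ω) ∂preWienerMeasure :=
        lintegral_withDensity_eq_lintegral_mul _ (measurable_rampDensity a τ₀)
          (hG.comp measurable_brownianPath)
    _ = _ := lintegral_congr fun ω => mul_comm _ _

end Summit.AtomisticToContinuum.BoseEinsteinCondensation.Cruxes.TwoReplicaTransienceBound.TaggedShiftLogHarnack

end
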